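import Summits.QuantumFields.BalabanUV.Beta.CombChartJointEndTablesParity
import Summits.QuantumFields.BalabanUV.Beta.RowD1JointEndSymWardTablesAn1

/-!
# `BalabanUV.Beta.CombChartJointEndTablesAn1` — binder row D1, RULING R-D1-g35-1 (chart (III′)), ROOT F⁗: **THE CHART-(III′) ROOT AT an1's FIRST-ORDER SYM TABLES** —
# ROOT F‴ `CombChartJointEndTablesParity` AT THE RECORD `tabs := SymTablesAn1FirstOrder.symTablesAn1 3 Lc cΛ vh₂S mixFF …` (`V := symVhSAt ρ_c 3 Lc`, `H := symHessFFAt ρ_c Lc`,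
# `M j := M1Of 3 Lc H cΛ j`) with SIX hW-SIDE LETTERS DISCHARGED BY NAME exactly as chart (II)'s `RowD1JointEndSymWardTablesAn1` (gen 29) does: (S-V)⁰⁴
# (`SymAveragingWardRootedStencils.divV_symVhSAt_eq_conjV_ctr`), (V-ff0) (`symVhSAt_hV0_ctr`), (M-H) (`rfl`), (V-p)(H-p) (`trK_symTablesAn1_V`∕`_H`), (T2-W) both slots with
# `RW = RW″ = 0` (`WilsonWardColourFree.hWil_wilson_TW₃_su`∕`hWil''_wilson_TW₃_su`, `2 ≤ N`)

HONEST FRAMING (cell contract, verbatim): «discharging `BetaPertH` makes Bałaban's UV stability UNCONDITIONAL — a real constructive-QFT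
result; it is NOT the continuum limit and NOT the Clay problem.»  HONEST DEPENDENCY: continuum YM on T⁴ ⇐ BetaPertH ∧ nine spine estimates (0/9 proved);
BetaPertH ⇐ (D1) ∧ (D4) ∧ CAP+tail; G-an2-4 gates asym, D1 and NE2/3/4.
DERIVED cell leaf ([folklore] wiring BY NAME; β sub-cell, BINDER-OWNERS row D1 OWNER `b2b-balaban-beta-an2` gen 36).  No statement of Bałaban's papers, no `[cite:]`,
no `Prop` fact, no `def`.  DISPLAYED (every one a BINDER): the two second-order sym tables `vh₂S`, `mixFF` with (LB)(Lmix)(TB)(Tmix); (T2-B)×4, (T2-M₂) with remainders,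
classes, parities; (V-r)×3, (H-r) of an1's concrete first-order tables; `γ`; (Wr-conj-rem) of `JsB12CombSh⁰` with `X₂ := diagK x₂`, `Rm`, `hRm0`; `D1Tel`; `D1Rep`; `h12`∕`h126`;
the window.  The literal is now `JsB12CombShSym hLc N (symTablesAn1 3 Lc cΛ vh₂S mixFF …) cΛ cB`.  THIS IS THE REPAIR TRACK (RULING R-D1-g35-1 (5)): the RECORD stays ROOT M′
p303989 over `JsB12Sym`.  NEXT (successor): the (III′) twins of `RowD1JointEndSymReflTablesAn1` … `…S2N` (the hR second-order engine chain at `GcombSh`, owner memo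
`HOME/b2b-balaban-beta-an2/gen36/P6-SCOPING-hR-chain.md`).  HONEST: composition by name; repair-track root classes 0∕4 discharged; row D1 binders 0∕4; NOT D1, NOT `BetaPertH`,
NOT continuum, NOT Clay.
Provenance: β sub-cell, unit beta-an2 gen 36, 2026-08-22 (v1); over this gen's `CombChartJointEndTablesParity` (F‴) and the chart-(II) suppliers named above BY NAME (imported
through `RowD1JointEndSymWardTablesAn1`); no existing file touched.
-/

noncomputable section

open Finset
open scoped BigOperators
open Literature.MathematicalPhysics.QuantumFieldTheory
open Literature.MathematicalPhysics.QuantumFieldTheory.Balaban1983to89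
open Literature.MathematicalPhysics.QuantumFieldTheory.Balaban1983to89.Beta
open Literature.MathematicalPhysics.QuantumFieldTheory.Balaban1983to89.Beta.VectorTailsLoc (fam kfam)
open Literature.MathematicalPhysics.QuantumFieldTheory.Balaban1983to89.Beta.VectorLegVolumeAdapter (MvE)
open ExpKernelCalculus (MKer BiLoc VertexFamily comp tr tadpole shiftK)
open PolarizationSign (reflSign WardTransversal AxisReflectionCovariant)
open KernelReflection (refK)
open ResolventReflection (bref Φ)
open AffineAveraging (box toSite)
open AveragingContoursRooted (ctr ctrOff ctrOff_mem_box)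
open OneStepResolventKernel (Fib LocStencil JetData)
open OneStepKernelFamily (KInvStep vertexOfK TbalOf flipK D1Tel D1Rep D1Drift)
open KernelWard (divV divW)
open StepJetData (mfNeg wilsonA)
open BalabanStepJetsSucc (wVH)
open SecondOrderResponse (dM LocStencilFM)
open BalabanCompositeJets (LocStencil₂)
open BalabanStepW2 (M2Of wB2)
open WilsonBiStencil (wilsonW₂)
open WilsonVertex2Sym (wsym22)
open Summit.QuantumFields.BalabanUV.Beta.TameKernelCalculus
open Summit.QuantumFields.BalabanUV.Beta.ChartConjugation (conjV conjW)
open Summit.QuantumFields.BalabanUV.Beta.AxialDressingRooted (one_le_of_neZero axEc)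
open Summit.QuantumFields.BalabanUV.Beta.AveragingWardRootedStencils (legInd)
open Summit.QuantumFields.BalabanUV.Beta.SymmetrisedStepJets (SymTables)
open Summit.QuantumFields.BalabanUV.Beta.SymShiftedSpread (bhKStepSh)
open Summit.QuantumFields.BalabanUV.Beta.BorderedHessian (sgnK bhK spr_bhK bhKStep stepScale diagK)
open Summit.QuantumFields.BalabanUV.Beta.E3ContactGenerator (ctGenM)
open Summit.QuantumFields.BalabanUV.Beta.KernelWardRelative (loc_zero comp_zero_left)
open StepDriftWitness (comp_zero_right)
open Summit.QuantumFields.BalabanUV.Beta.KernelWardLevels (loc_diagK_smul_sum_legInd)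
open Summit.QuantumFields.BalabanUV.Beta.WardLocusRecursiveStep (conjW_zero_zero_zero)
open Summit.QuantumFields.BalabanUV.Beta.VertexReflectionContact (smul_diagK)
open Summit.QuantumFields.BalabanUV.Beta.RowD1JointEndSym (locStencil_smul_diagK_ctGenM)
open Summit.QuantumFields.BalabanUV.Beta.RelInvNullShift (spr_add)
open Summit.QuantumFields.BalabanUV.Beta.DshAn1 (Dsh spr_Dsh linSym04At hVd_iff)
open Summit.QuantumFields.BalabanUV.Beta.CombChartStepJets (GcombSh ScombOf SpureCombOf WcombOf JsComb0Of_S JsComb0Of_W JsB12CombSh0 JsB12CombSh0_eq)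
open Summit.QuantumFields.BalabanUV.Beta.CombChartJointEnd (JsB12CombShSym)
open Summit.QuantumFields.BalabanUV.Beta.CombChartWardEnd (d1Drift_JsB12CombShSym_of_wardLettersParity_reflLettersRem_D1Tel_D1Rep)
open Summit.QuantumFields.BalabanUV.Beta.WardLocusCombShift (hSd_JsB12CombSh0)
open Summit.QuantumFields.BalabanUV.Beta.ReflectionLocusCombShift (hSrC_JsB12CombSh0)
open Summit.QuantumFields.BalabanUV.Beta.WardLocusCombSecondOrder (exists_kernelLaws_WcombOf_of_letters)

open Summit.QuantumFields.BalabanUV.Beta.SpineRooted (M1Of)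
open Summit.QuantumFields.BalabanUV.Beta.CombChartStepJets (decays_GcombSh SpureCombOf_eq)
open Summit.QuantumFields.BalabanUV.Beta.CombChartWardSockets (trK_GcombSh)
open Summit.QuantumFields.BalabanUV.Beta.SymmetrisedStepJetsParity (trK_SpureRecOf trK_M1Of)
open Summit.QuantumFields.BalabanUV.Beta.SpineRecursiveParity (parityOdd_zero)
open Summit.QuantumFields.BalabanUV.Beta.WardLocusWilsonEnd (locStencil_zero_apply)
open Summit.QuantumFields.BalabanUV.Beta.WilsonWardColourFree (hWil_wilson_TW₃_su hWil''_wilson_TW₃_su)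
open Summit.QuantumFields.BalabanUV.Beta.SymAveragingHessianCounts (symVhSAt symHessFFAt symVhSAt_hV0_ctr)
open Summit.QuantumFields.BalabanUV.Beta.SymAveragingWardRootedStencils (divV_symVhSAt_eq_conjV_ctr)
open Summit.QuantumFields.BalabanUV.Beta.SymTablesAn1FirstOrder (symTablesAn1 trK_symTablesAn1_V trK_symTablesAn1_H)
open Summit.QuantumFields.BalabanUV.Beta.CombChartJointEndTablesParity (d1Drift_JsB12CombShSym_of_wardTables_tableParity_reflLetters_D1Tel_D1Rep)
namespace Summit.QuantumFields.BalabanUV.Beta.CombChartJointEndTablesAn1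

variable {Lc : ℕ} [NeZero Lc]

/-- **ROW D1 — THE CHART-(III′) ROOT F⁗ AT an1's FIRST-ORDER SYM TABLES (`symTablesAn1 3 Lc cΛ vh₂S mixFF …`), SIX hW LETTERS DISCHARGED**: ROOT F‴ with (S-V)⁰⁴ supplied by
an1's `divV_symVhSAt_eq_conjV_ctr`, (V-ff0) by `symVhSAt_hV0_ctr`, (M-H) by `rfl`, (V-p)(H-p) by `trK_symTablesAn1_V`∕`_H`, and the level-0 Wilson letters (T2-W) (both slots, `RW = RW″ = 0`) by
`WilsonWardColourFree.hWil_wilson_TW₃_su` ∕ `hWil''_wilson_TW₃_su` (`2 ≤ N`).  Every other binder VERBATIM.  HONEST: composition by name; NOT D1, NOT `BetaPertH`, NOT continuum,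
NOT Clay. [folklore] -/
theorem d1Drift_JsB12CombShSym_an1Tables_of_bordMixLetters_reflLettersRem_D1Tel_D1Rep (hLc : Odd Lc) (hL2 : 2 ≤ Lc) {N : ℕ} (hN : 2 ≤ N) (cΛ cB : ℝ)
    -- the two SECOND-ORDER sym tables and their structure letters (LB)(Lmix)(TB)(Tmix) — an1's TABLES-SYM steps S2b+, displayed
    (vh₂S : Fin (3 + 1) → (Fin (3 + 1) → ℤ) → Fin (3 + 1) → (Fin (3 + 1) → ℤ) → MKer (3 + 1) (Fib 3))
    (mixFF : Fin (3 + 1) → (Fin (3 + 1) → ℤ) → Fin (3 + 1) → (Fin (3 + 1) → ℤ) → MKer (3 + 1) (Fib 3))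
    (hB : ∃ C δ : ℝ, 0 < δ ∧ LocStencil₂ vh₂S C δ) (hmix : ∃ C δ : ℝ, 0 < δ ∧ LocStencilFM Lc mixFF C δ)
    (hBt : ∀ (κ : Fin (3 + 1)) (u : Fin (3 + 1) → ℤ) (κ' : Fin (3 + 1)) (u' t : Fin (3 + 1) → ℤ),
      vh₂S κ (u + (Lc : ℤ) • t) κ' (u' + (Lc : ℤ) • t) = shiftK (-((Lc : ℤ) • t)) (vh₂S κ u κ' u'))
    (hmixt : ∀ (κ : Fin (3 + 1)) (u : Fin (3 + 1) → ℤ) (μ : Fin (3 + 1)) (w t : Fin (3 + 1) → ℤ),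
      mixFF κ (u + (Lc : ℤ) • t) μ (w + t) = shiftK (-((Lc : ℤ) • t)) (mixFF κ u μ w))
    -- hW, SECOND ORDER: the second-order TABLE letters' remainders, their classes (one rate per level) and row parities
    (RB RB'' : ℕ → (Fin 4 → ℤ) → Fin 4 → (Fin 4 → ℤ) → MKer 4 (Fib 3))
    (RM : ℕ → (Fin 4 → ℤ) → Fin 4 → (Fin 4 → ℤ) → MKer 4 (Fib 3))
    (hcls0 : ∃ C δ : ℝ, 0 < δ ∧ (∀ Y, LocStencil (RB 0 Y) C δ) ∧ (∀ Y, LocStencil (RB'' 0 Y) C δ) ∧ (∀ y, VertexFamily (RM 0 y) Lc C δ))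
    (hclsS : ∀ j : ℕ, ∃ C δ : ℝ, 0 < δ ∧ (∀ Y, LocStencil (RB (j + 1) Y) C δ) ∧ (∀ Y, LocStencil (RB'' (j + 1) Y) C δ) ∧
      (∀ y, VertexFamily (RM (j + 1) y) Lc C δ))
    (hRBp : ∀ j Y κ u, trK (RB j Y κ u) = -sgnK (RB j Y κ u)) (hRB''p : ∀ j Y κ u, trK (RB'' j Y κ u) = -sgnK (RB'' j Y κ u))
    (hRMp : ∀ j y ρ' w, trK (RM j y ρ' w) = -sgnK (RM j y ρ' w))
    (hBord0 : ∀ (Y : Fin 4 → ℤ) (κ' : Fin 4) (u' : Fin 4 → ℤ),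
      (stepScale 3 Lc 0 * (Lc : ℝ) ^ (3 + 1))⁻¹ • ∑ v ∈ box (3 + 1) Lc, divV (fun κ u => cB • vh₂S κ u κ' u') ((Lc : ℤ) • Y + toSite v) =
        comp ((-((Lc : ℝ) ^ (3 + 1) * (1 / 2) * (Lc : ℝ) ^ (3 + 1))) • symVhSAt (ctr 4 Lc) 3 Lc rfl κ' u') (diagK ((1 / 2 : ℝ) • ∑ v ∈ box (3 + 1) Lc, legInd (ctr (3 + 1) Lc) ((Lc : ℤ) • Y + toSite v)))
          - comp (diagK ((1 / 2 : ℝ) • ∑ v ∈ box (3 + 1) Lc, legInd (ctr (3 + 1) Lc) ((Lc : ℤ) • Y + toSite v))) ((-((Lc : ℝ) ^ (3 + 1) * (1 / 2) * (Lc : ℝ) ^ (3 + 1))) • symVhSAt (ctr 4 Lc) 3 Lc rfl κ' u') + RB 0 Y κ' u')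
    (hBord0'' : ∀ (Y : Fin 4 → ℤ) (κ : Fin 4) (u : Fin 4 → ℤ),
      (stepScale 3 Lc 0 * (Lc : ℝ) ^ (3 + 1))⁻¹ • ∑ v ∈ box (3 + 1) Lc, divV (fun κ' u' => cB • vh₂S κ u κ' u') ((Lc : ℤ) • Y + toSite v) =
        comp ((-((Lc : ℝ) ^ (3 + 1) * (1 / 2) * (Lc : ℝ) ^ (3 + 1))) • symVhSAt (ctr 4 Lc) 3 Lc rfl κ u) (diagK ((1 / 2 : ℝ) • ∑ v ∈ box (3 + 1) Lc, legInd (ctr (3 + 1) Lc) ((Lc : ℤ) • Y + toSite v)))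
          - comp (diagK ((1 / 2 : ℝ) • ∑ v ∈ box (3 + 1) Lc, legInd (ctr (3 + 1) Lc) ((Lc : ℤ) • Y + toSite v))) ((-((Lc : ℝ) ^ (3 + 1) * (1 / 2) * (Lc : ℝ) ^ (3 + 1))) • symVhSAt (ctr 4 Lc) 3 Lc rfl κ u) + RB'' 0 Y κ u)
    (hBordS : ∀ (j : ℕ) (Y : Fin 4 → ℤ) (κ' : Fin 4) (u' : Fin 4 → ℤ),
      (stepScale 3 Lc (j + 1) * (Lc : ℝ) ^ (3 + 1))⁻¹ • ∑ v ∈ box (3 + 1) Lc, divV (fun κ u => (cB * wB2 3 Lc (j + 1)) • vh₂S κ u κ' u') ((Lc : ℤ) • Y + toSite v) =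
        comp (((-((Lc : ℝ) ^ (3 + 1) * (1 / 2) * (Lc : ℝ) ^ (3 + 1))) * wVH 3 Lc (j + 1)) • symVhSAt (ctr 4 Lc) 3 Lc rfl κ' u') (diagK ((1 / 2 : ℝ) • ∑ v ∈ box (3 + 1) Lc, legInd (ctr (3 + 1) Lc) ((Lc : ℤ) • Y + toSite v)))
          - comp (diagK ((1 / 2 : ℝ) • ∑ v ∈ box (3 + 1) Lc, legInd (ctr (3 + 1) Lc) ((Lc : ℤ) • Y + toSite v))) (((-((Lc : ℝ) ^ (3 + 1) * (1 / 2) * (Lc : ℝ) ^ (3 + 1))) * wVH 3 Lc (j + 1)) • symVhSAt (ctr 4 Lc) 3 Lc rfl κ' u') + RB (j + 1) Y κ' u')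
    (hBordS'' : ∀ (j : ℕ) (Y : Fin 4 → ℤ) (κ : Fin 4) (u : Fin 4 → ℤ),
      (stepScale 3 Lc (j + 1) * (Lc : ℝ) ^ (3 + 1))⁻¹ • ∑ v ∈ box (3 + 1) Lc, divV (fun κ' u' => (cB * wB2 3 Lc (j + 1)) • vh₂S κ u κ' u') ((Lc : ℤ) • Y + toSite v) =
        comp (((-((Lc : ℝ) ^ (3 + 1) * (1 / 2) * (Lc : ℝ) ^ (3 + 1))) * wVH 3 Lc (j + 1)) • symVhSAt (ctr 4 Lc) 3 Lc rfl κ u) (diagK ((1 / 2 : ℝ) • ∑ v ∈ box (3 + 1) Lc, legInd (ctr (3 + 1) Lc) ((Lc : ℤ) • Y + toSite v)))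
          - comp (diagK ((1 / 2 : ℝ) • ∑ v ∈ box (3 + 1) Lc, legInd (ctr (3 + 1) Lc) ((Lc : ℤ) • Y + toSite v))) (((-((Lc : ℝ) ^ (3 + 1) * (1 / 2) * (Lc : ℝ) ^ (3 + 1))) * wVH 3 Lc (j + 1)) • symVhSAt (ctr 4 Lc) 3 Lc rfl κ u) + RB'' (j + 1) Y κ u)
    (hM₂ : ∀ (j : ℕ) (y : Fin 4 → ℤ) (ρ' : Fin 4) (w : Fin 4 → ℤ),
      (stepScale 3 Lc j * (Lc : ℝ) ^ (3 + 1))⁻¹ • ∑ v ∈ box (3 + 1) Lc, divV (fun κ u => M2Of 3 Lc mixFF j κ u ρ' w) ((Lc : ℤ) • y + toSite v) =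
        comp (M1Of 3 Lc (symHessFFAt (ctr 4 Lc) Lc) cΛ j ρ' w) (diagK ((1 / 2 : ℝ) • ∑ v ∈ box (3 + 1) Lc, legInd (ctr (3 + 1) Lc) ((Lc : ℤ) • y + toSite v))) - comp (diagK ((1 / 2 : ℝ) • ∑ v ∈ box (3 + 1) Lc, legInd (ctr (3 + 1) Lc) ((Lc : ℤ) • y + toSite v))) (M1Of 3 Lc (symHessFFAt (ctr 4 Lc) Lc) cΛ j ρ' w) + RM j y ρ' w)
    -- hR, first order: the tables' REFLECTION letters (V-r)(V-ff0)(H-r)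
    (hVfm : ∀ (α κ' : Fin 4) (u x z : Fin 4 → ℤ) (β m : Fin 4), symVhSAt (ctr 4 Lc) 3 Lc rfl κ' (bref α κ' u) x z (Sum.inl β) (Sum.inr m) =
      (reflSign α κ' • refK (Φ (d := 3) Lc α) (symVhSAt (ctr 4 Lc) 3 Lc rfl κ' u + conjV (bhK (d := 3) Lc + Dsh Lc)
        ((((Lc : ℝ) ^ 4)⁻¹) • diagK (ctGenM 3 (bhK Lc + Dsh Lc) α Lc κ' u)))) x z (Sum.inl β) (Sum.inr m))
    (hVmf : ∀ (α κ' : Fin 4) (u x z : Fin 4 → ℤ) (m β : Fin 4), symVhSAt (ctr 4 Lc) 3 Lc rfl κ' (bref α κ' u) x z (Sum.inr m) (Sum.inl β) =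
      (reflSign α κ' • refK (Φ (d := 3) Lc α) (symVhSAt (ctr 4 Lc) 3 Lc rfl κ' u + conjV (bhK (d := 3) Lc + Dsh Lc)
        ((((Lc : ℝ) ^ 4)⁻¹) • diagK (ctGenM 3 (bhK Lc + Dsh Lc) α Lc κ' u)))) x z (Sum.inr m) (Sum.inl β))
    (hVmm : ∀ (α κ' : Fin 4) (u x z : Fin 4 → ℤ) (m m' : Fin 4), symVhSAt (ctr 4 Lc) 3 Lc rfl κ' (bref α κ' u) x z (Sum.inr m) (Sum.inr m') =
      (reflSign α κ' • refK (Φ (d := 3) Lc α) (symVhSAt (ctr 4 Lc) 3 Lc rfl κ' u + conjV (bhK (d := 3) Lc + Dsh Lc)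
        ((((Lc : ℝ) ^ 4)⁻¹) • diagK (ctGenM 3 (bhK Lc + Dsh Lc) α Lc κ' u)))) x z (Sum.inr m) (Sum.inr m'))
    (hHr : ∀ (α μ : Fin 4) (y : Fin 4 → ℤ), symHessFFAt (ctr 4 Lc) Lc μ (bref α μ y) = reflSign α μ • refK (Φ (d := 3) Lc α) (symHessFFAt (ctr 4 Lc) Lc μ y))
    -- the first-order contact coefficient, displayed
    (γ : ℕ → ℝ) (hγ : ∀ j, γ j = -((Lc : ℝ) ^ 8 / 2) * wVH 3 Lc j / (stepScale 3 Lc j * (Lc : ℝ) ^ 4))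
    -- hR, second order: the reflection letter (Wr-conj-rem) of the undressed comb-chart jets with the PINNED first-order contacts, diagonal `X₂`, tadpole-null remainder
    (x₂ : ℕ → Fin 4 → Fin 4 → (Fin 4 → ℤ) → Fin 4 → (Fin 4 → ℤ) → (Fin 4 → ℤ) → Fib 3 → ℝ)
    (hX₂ : ∀ j α μ y ν y', Loc (diagK (x₂ j α μ y ν y')))
    (Rm : ℕ → Fin 4 → Fin 4 → (Fin 4 → ℤ) → Fin 4 → (Fin 4 → ℤ) → MKer 4 (Fib 3))
    (hRmL : ∀ j α μ y ν y', Loc (Rm j α μ y ν y'))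
    (hRm0 : ∀ j α μ y ν y', tadpole (GcombSh Lc j) (Rm j α μ y ν y') = 0)
    (hWrC : ∀ (j : ℕ) (α μ : Fin 4) (y : Fin 4 → ℤ) (ν : Fin 4) (y' : Fin 4 → ℤ),
      (JsB12CombSh0 hLc N (symTablesAn1 3 Lc cΛ vh₂S mixFF hB hmix hBt hmixt) cΛ cB j).W μ (bref α μ y) ν (bref α ν y') = (reflSign α μ * reflSign α ν) • refK (Φ Lc α)
        ((JsB12CombSh0 hLc N (symTablesAn1 3 Lc cΛ vh₂S mixFF hB hmix hBt hmixt) cΛ cB j).W μ y ν y' +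
          conjW (bhKStepSh 3 Lc (Dsh Lc) j) (vertexOfK (GcombSh Lc j) Lc (JsB12CombSh0 hLc N (symTablesAn1 3 Lc cΛ vh₂S mixFF hB hmix hBt hmixt) cΛ cB j).S μ y)
            (vertexOfK (GcombSh Lc j) Lc (JsB12CombSh0 hLc N (symTablesAn1 3 Lc cΛ vh₂S mixFF hB hmix hBt hmixt) cΛ cB j).S ν y')
            (vertexOfK (GcombSh Lc j) Lc (fun κ u => diagK (fun p a => γ j * ctGenM 3 (bhK Lc + Dsh Lc) α Lc κ u p a)) μ y)
            (vertexOfK (GcombSh Lc j) Lc (fun κ u => diagK (fun p a => γ j * ctGenM 3 (bhK Lc + Dsh Lc) α Lc κ u p a)) ν y')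
            (diagK (x₂ j α μ y ν y')) + Rm j α μ y ν y'))
    -- the route theorem's own binders, verbatim
    (a : ℝ) (ha : 0 < a)
    (h12 : B5.Prop12Printed (fam (fun i : ℕ+ × ℕ => ((i.1 : ℕ+) : ℕ)) (fun i => i.1.pos) MvE a ha))
    (h126 : B5.Kernel126_127Printed (kfam (fun i : ℕ+ × ℕ => ((i.1 : ℕ+) : ℕ)) MvE))
    {L : Type*} {SL : Finset L} (hSL : SL.Nonempty) (k : L → Fin 4) {μ ν : Fin 4} (hμν : μ ≠ ν) {Nc : ℝ} (hNc : Nc ≠ 0)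
    (Jc : ∀ m : ℕ, JetData 3 (Lc ^ m))
    (htel : D1Tel Lc (JsB12CombShSym hLc N (symTablesAn1 3 Lc cΛ vh₂S mixFF hB hmix hBt hmixt) cΛ cB) Jc)
    {cc : ℝ} {Mw' : ℕ → ℕ} (hc : 1 ≤ cc) (hMwin : ∀ L : ℕ, 2 ≤ L → 1 ≤ Mw' L ∧ (L : ℝ) ≤ cc * Mw' L) (hML : ∀ L : ℕ, 2 ≤ L → Mw' L ≤ L)
    (hrep : D1Rep Lc Jc Nc μ ν a SL k) :
    D1Drift Lc (JsB12CombShSym hLc N (symTablesAn1 3 Lc cΛ vh₂S mixFF hB hmix hBt hmixt) cΛ cB) Nc μ ν := by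
  obtain ⟨C0, δ0, hδ0, hRBl, hRB''l, hRMl⟩ := hcls0
  have hC0 : 0 ≤ C0 := (hRMl 0 0 0).nonneg (Sum.inl 0)
  exact d1Drift_JsB12CombShSym_of_wardTables_tableParity_reflLetters_D1Tel_D1Rep hLc hL2 N (symTablesAn1 3 Lc cΛ vh₂S mixFF hB hmix hBt hmixt) cΛ cB
    (divV_symVhSAt_eq_conjV_ctr (d := 3) (one_le_of_neZero Lc))
    (fun _ _ _ => rfl)
    (trK_symTablesAn1_V cΛ vh₂S mixFF hB hmix hBt hmixt)
    (trK_symTablesAn1_H cΛ vh₂S mixFF hB hmix hBt hmixt)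
    0 0 RB RB'' RM
    ⟨C0, δ0, hδ0, locStencil_zero_apply hC0, locStencil_zero_apply hC0, hRBl, hRB''l, hRMl⟩ hclsS
    (fun _ _ _ => parityOdd_zero) (fun _ _ _ => parityOdd_zero) hRBp hRB''p hRMp
    (hWil_wilson_TW₃_su hN Lc (ctrOff 4 Lc) rfl) (hWil''_wilson_TW₃_su hN Lc (ctrOff 4 Lc) rfl)
    hBord0 hBord0'' hBordS hBordS'' hM₂ hVfm hVmf hVmm (symVhSAt_hV0_ctr Lc) hHr γ hγ x₂ hX₂ Rm hRmL hRm0 hWrC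
    a ha h12 h126 hSL k hμν hNc Jc htel hc hMwin hML hrep

end Summit.QuantumFields.BalabanUV.Beta.CombChartJointEndTablesAn1

end
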